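import Summits.KontsevichZagierPeriods.Zeta5Search.LaiSweepShard

/-!
# `κ₃` sweep certificate — shard file 029 of 127 (shards 203–209 of 889)

HONEST FRAMING. Systematic search; no irrationality claim unless certified. This file only checks,
by `decide +kernel`, shards 203–209 of the order-cell sweep of the `κ₃` point `(74, 2180, 444; δ74)`
(engine `LaiSweepEngine`, soundness `LaiSweepJump/Free/Eval/Shard/Kappa3`; a shard is `⟨regime, n,
p, q, p', q', Lo, Up⟩`: `n` cells from `p/q` to `p'/q'` with integer rate sums in `[Lo, Up]`, `K =
128`, `D = 2^40`). It draws NO conclusion: only the capstone `LaiKappa3SweepCert`, which needs all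
127 shard files, does. Kernel cost of this file ≈ 560 cells × 0.3 s.
-/

namespace Summit.KontsevichZagierPeriods.Zeta5Search.Sweep

set_option maxHeartbeats 100000000 in
/-- Shard 203: 80 cells of regime B from `7/51` to `41/296`.
[cite: Lai2024BallRivoal, §4 Lemma 4.3] -/
theorem shard203 :
    Shard.check 128 (2^40)
      ⟨true, 80, 7, 51, 41, 296, 47143607908341, 47713365017154⟩ = true := by
  decide +kernel

set_option maxHeartbeats 100000000 in
/-- Shard 204: 80 cells of regime B from `41/296` to `45/322`.
[cite: Lai2024BallRivoal, §4 Lemma 4.3] -/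
theorem shard204 :
    Shard.check 128 (2^40)
      ⟨true, 80, 41, 296, 45, 322, 46006486053385, 46572767268442⟩ = true := by
  decide +kernel

set_option maxHeartbeats 100000000 in
/-- Shard 205: 80 cells of regime B from `45/322` to `54/383`.
[cite: Lai2024BallRivoal, §4 Lemma 4.3] -/
theorem shard205 :
    Shard.check 128 (2^40)
      ⟨true, 80, 45, 322, 54, 383, 45625361167721, 46198391761458⟩ = true := by
  decide +kernel

set_option maxHeartbeats 100000000 in
/-- Shard 206: 80 cells of regime B from `54/383` to `30/211`.
[cite: Lai2024BallRivoal, §4 Lemma 4.3] -/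
theorem shard206 :
    Shard.check 128 (2^40)
      ⟨true, 80, 54, 383, 30, 211, 43326421535465, 43880052831311⟩ = true := by
  decide +kernel

set_option maxHeartbeats 100000000 in
/-- Shard 207: 80 cells of regime B from `30/211` to `55/383`.
[cite: Lai2024BallRivoal, §4 Lemma 4.3] -/
theorem shard207 :
    Shard.check 128 (2^40)
      ⟨true, 80, 30, 211, 55, 383, 51297388933326, 51988494856882⟩ = true := by
  decide +kernel

set_option maxHeartbeats 100000000 in
/-- Shard 208: 80 cells of regime B from `55/383` to `53/366`.
[cite: Lai2024BallRivoal, §4 Lemma 4.3] -/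
theorem shard208 :
    Shard.check 128 (2^40)
      ⟨true, 80, 55, 383, 53, 366, 43157436456350, 43732604737839⟩ = true := by
  decide +kernel

set_option maxHeartbeats 100000000 in
/-- Shard 209: 80 cells of regime B from `53/366` to `58/397`.
[cite: Lai2024BallRivoal, §4 Lemma 4.3] -/
theorem shard209 :
    Shard.check 128 (2^40)
      ⟨true, 80, 53, 366, 58, 397, 45785815215025, 46409561631438⟩ = true := by
  decide +kernel

/-- The checked shards of this file, in order. [folklore] -/
def shards029 : List (CheckedShard 128 (2^40)) :=
  [⟨_, shard203⟩, ⟨_, shard204⟩, ⟨_, shard205⟩, ⟨_, shard206⟩, ⟨_, shard207⟩,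
    ⟨_, shard208⟩, ⟨_, shard209⟩]

end Summit.KontsevichZagierPeriods.Zeta5Search.Sweep
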